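import Mathlib
import Summits.Ventures.HodgeRepro.Tier4.Common.AdelicDefs
import Summits.Ventures.HodgeRepro.Tier4.Common.SettingOfData
import Summits.Ventures.HodgeRepro.Tier4.Common.MixedPlane
import Summits.Ventures.HodgeRepro.Tier4.Common.RowPlane
import Summits.Ventures.HodgeRepro.Tier4.Common.RowTorus
import Summits.Ventures.HodgeRepro.Tier4.Line1.RTFSetting
import Summits.Ventures.HodgeRepro.Tier4.Line1.PlaneDefs
import Summits.Ventures.HodgeRepro.Tier4.Line4.LevelCosetCongruence
import Summits.Ventures.HodgeRepro.Tier4.Line4.OrbitInvariant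
import Summits.Ventures.HodgeRepro.Tier4.Line4.OrbitInvariantFibre
import Summits.Ventures.HodgeRepro.Tier4.Line4.LinRegularCoords
import Summits.Ventures.HodgeRepro.Tier4.Line4.TraceShift
import Summits.Ventures.HodgeRepro.Tier4.Line4.OrbitInvariantFibreTrace

/-!
# Tier4/Line4/LinRegularBridgeTrace — the fibre bridge with `IsLinRegular` binders, general trace
(C-L4-REGCOORD ∘ C-L4-TRACE-WLOG)

Blind re-derivation cell `pub-hodge-repro`, Tier 4 «prove the step» (README §9–§10), seat t4-L1-p3 (gen 4).
Tree path `lean/Summits/Ventures/HodgeRepro/Tier4/Line4/LinRegularBridgeTrace.lean`.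

LinRegularBridge's `orbitInv_ne_of_orbitOf_ne_of_isLinRegular` (p709341) composes OrbitInvariantFibre (`t = 0`) with
LinRegularCoords; here the same composition with OrbitInvariantFibreTrace's `orbitInv_ne_of_orbitOf_ne_trace`
(p710199): **`IsLinRegular W γ → IsLinRegular W γ₀ → orbitOf γ ≠ orbitOf γ₀ → orbitInv γ ≠ orbitInv γ₀`** on the
transported row plane with the single discriminant binder `hd : ¬ IsSquare (q.t ^ 2 - 4 * q.n)` in place of
`ht hn hd` (`hq : q.t ^ 2 - 4 * q.n ≠ 0` for LinRegularCoords follows: `0` is a square).  The `hbridge` hypothesis of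
the `hR` wrapper (HRWrapper p709223/p709495) without the trace normalisation.  No printed input.
HC_CM is NOT proved by anyone in this repository.
-/

namespace Summit.Ventures.HodgeRepro.Tier4.Line4

open Summit.Ventures.HodgeRepro.Tier4.Common Summit.Ventures.HodgeRepro.Tier4.Line1.RTF NumberField Matrix
  MeasureTheory
open scoped NumberField

noncomputable section

section Bridge

variable {k : Type} [Field k] [NumberField k] (q : QuadData k) (a b ε a' b' ε' : k)
  (g g' : Matrix (Fin 4) (Fin 4) k) (hgg' : g * g' = 1) (hg'g : g' * g = 1)
  (hgΩ : g * (PlaneData.ofLinesRow q a b ε).Ω = (PlaneData.ofLinesRow q a b ε).Ω * g)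
  (W : PlaneData k) (hW : W = (PlaneData.ofLinesRow q a b ε).withTransportedTorus g g' hgg' hg'g hgΩ)
  [MeasurableSpace (GA W)] [BorelSpace (GA W)] (R : RTFData W) (μ : Measure (GA W))
  [μ.IsHaarMeasure] [R.μT.IsHaarMeasure] [R.μT'.IsHaarMeasure] (DG : Set (GA W))
  (fdG : IsFundamentalDomain (rationalPoints W) DG μ) (compG : IsCompact (closure DG))
  (compT : IsCompact (closure R.DT)) (compT' : IsCompact (closure R.DT'))

include hW in
/-- **OFF THE ORBIT, OFF THE FIBRE, with `IsLinRegular` binders — GENERAL TRACE**: on the transported row plane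
(`t² − 4n` not a square, similitude `g B′ gᵀ = λ B`), two linearly regular rational points in different orbits of
the Setting have different orbit invariants. -/
theorem orbitInv_ne_of_orbitOf_ne_of_isLinRegular_trace (hd : ¬ IsSquare (q.t ^ 2 - 4 * q.n))
    (ha : a ≠ 0) (hb : b ≠ 0) (hε : ε ≠ 0) (ha' : a' ≠ 0) (hb' : b' ≠ 0) (hε' : ε' ≠ 0) (lam : k) (hlam : lam ≠ 0)
    (hiso : g * (PlaneData.ofLinesRow q a' b' ε').B * gᵀ = lam • (PlaneData.ofLinesRow q a b ε).B)
    {γ γ₀ : (Setting.ofAdelicData W R μ DG fdG compG compT compT').Gk}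
    (hreg : Line1.IsLinRegular W γ) (hreg₀ : Line1.IsLinRegular W γ₀)
    (hne : (Setting.ofAdelicData W R μ DG fdG compG compT compT').orbitOf γ ≠
      (Setting.ofAdelicData W R μ DG fdG compG compT compT').orbitOf γ₀) :
    orbitInv W g (γ : GA W) ≠ orbitInv W g (γ₀ : GA W) := by
  have hq : q.t ^ 2 - 4 * q.n ≠ 0 := by
    intro h0
    exact hd ⟨0, by rw [h0, mul_zero]⟩
  obtain ⟨m, hm⟩ := exists_rational_mat_of_mem_rationalPoints W γ.2
  obtain ⟨m₀, hm₀⟩ := exists_rational_mat_of_mem_rationalPoints W γ₀.2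
  subst hW
  exact orbitInv_ne_of_orbitOf_ne_trace q a b ε a' b' ε' g g' hgg' hg'g hgΩ _ rfl R μ DG fdG compG compT compT'
    hd ha ha' hb' hε' lam hlam hiso hm hm₀
    (hreg_of_isLinRegular q a b ε a' b' ε' g g' hgg' hg'g hgΩ hq ha hb hε ha' hb' hε' lam hlam hiso hreg hm)
    (hreg_of_isLinRegular q a b ε a' b' ε' g g' hgg' hg'g hgΩ hq ha hb hε ha' hb' hε' lam hlam hiso hreg₀ hm₀) hne

end Bridge

end

end Summit.Ventures.HodgeRepro.Tier4.Line4
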